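import Summits.QuantumFields.YangMills.Theorems.CentreWallReflectionSlabSemigroup
import Summits.QuantumFields.YangMills.Theorems.CentreWallReflectionSlabPSDDefs
import Summits.QuantumFields.YangMills.Theorems.FemtoTransferGapPositivityGram
import HarnessLib

/-!
# Slab decomposition of the four-torus Wilson weight, VIII: positivity of the one-layer kernel (Osterwalder–Seiler, no gauge fixing)
# (crux `CentreWallReflection.WallReflection` ⟨stmt-QuantumFields-23707⟩, line `birth`, stub `stub_instantiate`; planner ym-idea-4 g18)

The Gram identity `Re tr ρ(b a⁻¹) = Σ_{ik}(Re ρ(a)_{ik} Re ρ(b)_{ik} + Im ρ(a)_{ik} Im ρ(b)_{ik})` for unitary `ρ`, gauge invariance of the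
layer Gram form, the one-layer slab action of a glued configuration (two half spatial actions + temporal Gram coupling), the kernel in Gram
form, GAUGE AVERAGING `∫e^{βΓ(A,U·A')}dU = ∫∫e^{βΓ(H·A,U·A')}dUdH`, and `slabKernel_one_psd`: `0 ≤ ∫∫ φ(A)Ψ_1(A,A')φ(A')` for bounded measurable
`φ` (Fubini to the product space `(Ω×Ω)²` and `FemtoTransferGap.integral_prod_exp_gram_nonneg`).
HONEST FRAMING: lattice bookkeeping toward ONE crux of a draft route (fixed torus, finite lattice); nothing here proves the route's target
`MarginalTwistOnset.FixedTorusCriterionFailure`, any continuum statement, or the Yang–Mills mass gap.  THEOREMS ONLY (no `def`, no `sorry`),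
standard axioms.  References: [cite: OsterwalderSeiler1978, §2]; [cite: tHooft1979]; E. T. Tomboulis, L. G. Yaffe, CMP 100 (1985) 313;
[cite: Luscher1983, §2].
-/

set_option autoImplicit false

noncomputable section

open scoped BigOperators
open MeasureTheory Literature.MathematicalPhysics.QuantumFieldTheory

namespace Summit.QuantumFields.YangMills.Theorems.CentreWallReflection.Slab

open MeasureTheory
open Literature.MathematicalPhysics.QuantumFieldTheory.LatticeRP (splice measurePreserving_splice measurable_splice)

/-! ## §19 Positivity of the one-layer kernel (Osterwalder–Seiler, no gauge fixing) -/

section PSDDefs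

variable {n : ℕ} {G : Type*} [Group G] {N : ℕ} (ρ : G →* Matrix (Fin N) (Fin N) ℂ) (μ : Fin 4)

end PSDDefs

section PSDAlgebra

variable {n : ℕ} {G : Type*} [Group G] {N : ℕ} (ρ : G →* Matrix (Fin N) (Fin N) ℂ) (μ : Fin 4)

/-- **The Gram identity** `Re tr ρ(b a⁻¹) = Σ_{ik} (Re ρ(a)_{ik} Re ρ(b)_{ik} + Im ρ(a)_{ik} Im ρ(b)_{ik})` for unitary `ρ`. -/
theorem re_trace_mul_inv_eq_gram (hU : ∀ g, ρ g ∈ Matrix.unitaryGroup (Fin N) ℂ) (a b : G) :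
    (ρ (b * a⁻¹)).trace.re = ∑ i : Fin N, ∑ k : Fin N, ((ρ a i k).re * (ρ b i k).re + (ρ a i k).im * (ρ b i k).im) := by
  rw [map_mul, Literature.Barriers.QuantumFields.FiniteTemperature.rep_inv_eq_star ρ hU, Matrix.trace, Complex.re_sum]
  refine Finset.sum_congr rfl fun i _ => ?_
  rw [Matrix.diag_apply, Matrix.mul_apply, Complex.re_sum]
  refine Finset.sum_congr rfl fun k _ => ?_
  rw [Matrix.star_apply, Complex.star_def, Complex.mul_re, Complex.conj_re, Complex.conj_im]
  ring

/-- Entries of a unitary matrix are bounded by one in modulus: real parts. -/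
theorem abs_re_entry_le_one (hU : ∀ g, ρ g ∈ Matrix.unitaryGroup (Fin N) ℂ) (g : G) (i k : Fin N) : |(ρ g i k).re| ≤ 1 ∧ |(ρ g i k).im| ≤ 1 := by
  have h2 : ρ g * star (ρ g) = 1 := Matrix.mem_unitaryGroup_iff.mp (hU g)
  have hii : (ρ g * star (ρ g)) i i = 1 := by rw [h2, Matrix.one_apply_eq]
  rw [Matrix.mul_apply] at hii
  have hsum : ∑ j, Complex.normSq (ρ g i j) = 1 := by
    have := congrArg Complex.re hii
    rw [Complex.re_sum, Complex.one_re] at this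
    rw [← this]
    refine Finset.sum_congr rfl fun j _ => ?_
    rw [Matrix.star_apply, Complex.star_def, Complex.mul_conj, Complex.ofReal_re]
  have hle : Complex.normSq (ρ g i k) ≤ 1 := by
    rw [← hsum]; exact Finset.single_le_sum (fun j _ => Complex.normSq_nonneg _) (Finset.mem_univ k)
  have hsq : (ρ g i k).re ^ 2 + (ρ g i k).im ^ 2 ≤ 1 := by rw [Complex.normSq_apply] at hle; nlinarith
  constructor
  · rw [abs_le]; constructor <;> nlinarith [sq_nonneg ((ρ g i k).im), sq_nonneg ((ρ g i k).re + 1), sq_nonneg ((ρ g i k).re - 1)]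
  · rw [abs_le]; constructor <;> nlinarith [sq_nonneg ((ρ g i k).re), sq_nonneg ((ρ g i k).im + 1), sq_nonneg ((ρ g i k).im - 1)]

/-- The features are bounded by one. -/
theorem abs_plaqFeature_le_one (hU : ∀ g, ρ g ∈ Matrix.unitaryGroup (Fin N) ℂ) (f : Plaquette 4 (n + 1) × Fin N × Fin N × Bool)
    (A : GaugeConfig 4 (n + 1) G) : |plaqFeature ρ μ f A| ≤ 1 := by
  unfold plaqFeature
  split_ifs
  · exact (abs_re_entry_le_one ρ hU _ _ _).1
  · exact (abs_re_entry_le_one ρ hU _ _ _).2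
  · simp

/-- The Gram form is the sum over the layer-`0` temporal plaquettes of `Re tr ρ(B_ℓ A_ℓ⁻¹)`. -/
theorem plaqGram_eq_sum (hU : ∀ g, ρ g ∈ Matrix.unitaryGroup (Fin N) ℂ) (A B : GaugeConfig 4 (n + 1) G) :
    plaqGram ρ μ A B = ∑ p : Plaquette 4 (n + 1),
      (if isTemporal μ p = true ∧ (p.1 μ).val = 0 then (ρ (B (plaqEdge μ p) * (A (plaqEdge μ p))⁻¹)).trace.re else 0) := by
  unfold plaqGram
  rw [Fintype.sum_prod_type]
  refine Finset.sum_congr rfl fun p _ => ?_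
  by_cases hp : isTemporal μ p = true ∧ (p.1 μ).val = 0
  · rw [if_pos hp, re_trace_mul_inv_eq_gram ρ hU, Fintype.sum_prod_type]
    refine Finset.sum_congr rfl fun i _ => ?_
    rw [Fintype.sum_prod_type]
    refine Finset.sum_congr rfl fun k _ => ?_
    simp only [plaqFeature, hp, and_self, if_true, Fintype.sum_bool, Bool.false_eq_true, if_false]
  · rw [if_neg hp]
    refine Finset.sum_eq_zero fun f _ => ?_
    simp only [plaqFeature, if_neg hp, zero_mul]

/-- **Gauge invariance of the Gram form**: `plaqGram (H·A) (H·B) = plaqGram A B`. -/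
theorem plaqGram_gaugeAct (hU : ∀ g, ρ g ∈ Matrix.unitaryGroup (Fin N) ℂ) (H A B : GaugeConfig 4 (n + 1) G) :
    plaqGram ρ μ (gaugeAct μ H A) (gaugeAct μ H B) = plaqGram ρ μ A B := by
  rw [plaqGram_eq_sum ρ μ hU, plaqGram_eq_sum ρ μ hU]
  refine Finset.sum_congr rfl fun p _ => ?_
  by_cases hp : isTemporal μ p = true ∧ (p.1 μ).val = 0
  · rw [if_pos hp, if_pos hp]
    have he : (plaqEdge μ p).2 ≠ μ ∧ (plaqEdge μ p).1 μ = 0 := by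
      refine ⟨?_, (ZMod.val_eq_zero _).mp hp.2⟩
      obtain ⟨x, ⟨⟨a, b⟩, hab⟩⟩ := p
      simp only [plaqEdge, spatialDir]
      split_ifs with h
      · intro hb
        have hab' : a < b := hab
        rw [h, hb] at hab'; exact lt_irrefl _ hab'
      · exact h
    simp only [gaugeAct, he, ne_eq, not_false_eq_true, and_self, if_true]
    set e := plaqEdge μ p
    have e1 : H (e.1, μ) * B e * (H (e.1.shift e.2, μ))⁻¹ * (H (e.1, μ) * A e * (H (e.1.shift e.2, μ))⁻¹)⁻¹ =
        H (e.1, μ) * (B e * (A e)⁻¹) * (H (e.1, μ))⁻¹ := by group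
    rw [e1, map_mul, map_mul, Matrix.trace_mul_cycle, ← map_mul, inv_mul_cancel, map_one, one_mul]
  · rw [if_neg hp, if_neg hp]

/-- The layer multiplication composes gauge actions. -/
theorem gaugeAct_layerMul (H U A : GaugeConfig 4 (n + 1) G) :
    gaugeAct μ (layerMul μ H U) A = gaugeAct μ H (gaugeAct μ U A) := by
  funext e
  simp only [gaugeAct, layerMul]
  by_cases he : e.2 ≠ μ ∧ e.1 μ = 0
  · rw [if_pos he, if_pos he, if_pos he]
    have h2 : (e.1.shift e.2) μ = 0 := by rw [shift_apply_of_ne' e.1 (Ne.symm he.1)]; exact he.2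
    simp only [he.2, h2, and_self, if_true]
    group
  · rw [if_neg he, if_neg he, if_neg he]

end PSDAlgebra

end Summit.QuantumFields.YangMills.Theorems.CentreWallReflection.Slab

namespace Summit.QuantumFields.YangMills.Theorems.CentreWallReflection.Slab

open MeasureTheory
open Literature.MathematicalPhysics.QuantumFieldTheory.LatticeRP (splice measurePreserving_splice measurable_splice)

section PSDKernel

variable {n : ℕ} {G : Type*} [Group G] {N : ℕ} (ρ : G →* Matrix (Fin N) (Fin N) ℂ) (μ : Fin 4)

/-- A temporal plaquette's spatial direction is not `μ`, and the plaquette is `(x; μ, λ)` or `(x; λ, μ)`. -/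
theorem spatialDir_spec {p : Plaquette 4 (n + 1)} (hp : isTemporal μ p = true) :
    spatialDir μ p ≠ μ ∧ ((p.2.1.1 = μ ∧ p.2.1.2 = spatialDir μ p) ∨ (p.2.1.2 = μ ∧ p.2.1.1 = spatialDir μ p)) := by
  obtain ⟨x, ⟨⟨a, b⟩, hab⟩⟩ := p
  have hab' : a < b := hab
  rw [isTemporal_iff] at hp
  simp only [spatialDir]
  rcases hp with ha | hb
  · simp only at ha; subst ha
    refine ⟨?_, Or.inl ⟨rfl, by simp⟩⟩
    simp only [if_true]; exact (ne_of_lt hab').symm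
  · simp only at hb; subst hb
    have hne : a ≠ b := ne_of_lt hab'
    refine ⟨by simp [hne], Or.inr ⟨rfl, by simp [hne]⟩⟩

/-- **The temporal plaquettes of the one-layer glued configuration**: `c_p = N − Re tr ρ((U·A')_ℓ A_ℓ⁻¹)`. -/
theorem plaqCost_glue_one_temporal (hn : 1 ≤ n) (hU : ∀ g, ρ g ∈ Matrix.unitaryGroup (Fin N) ℂ) (U A A' : GaugeConfig 4 (n + 1) G)
    {p : Plaquette 4 (n + 1)} (hp : isTemporal μ p = true ∧ (p.1 μ).val = 0) :
    plaqCost ρ (glue μ 1 U A A') p = (N : ℝ) - (ρ (gaugeAct μ U A' (plaqEdge μ p) * (A (plaqEdge μ p))⁻¹)).trace.re := by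
  have h10 : ((1 : ℕ) : ZMod (n + 1)) ≠ 0 := natCast_ne_zero_of_le (n := n) 1 le_rfl hn
  obtain ⟨x, ⟨⟨a, b⟩, hab⟩⟩ := p
  have hab' : a < b := hab
  have hx0 : x μ = 0 := (ZMod.val_eq_zero _).mp hp.2
  have hT : a = μ ∨ b = μ := (isTemporal_iff μ _).mp hp.1
  -- the four link values, for a spatial direction `c ≠ μ`
  have hv1 : ∀ y : Site 4 (n + 1), glue μ 1 U A A' (y, μ) = U (y, μ) := fun y => glue_apply_other μ 1 U A A' (Or.inl rfl)
  have hv2 : ∀ {c : Fin 4}, c ≠ μ → glue μ 1 U A A' (x.shift μ, c) = A' (x, c) := by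
    intro c hc
    rw [glue_apply_sliceJ μ 1 U A A' hc h10 (by show (x.shift μ) μ = _; rw [shift_apply_self', hx0, zero_add, Nat.cast_one])]
    congr 1
    simp only [Site.shift, Nat.cast_one, add_sub_cancel_right]
  have hv4 : ∀ {c : Fin 4}, c ≠ μ → glue μ 1 U A A' (x, c) = A (x, c) := fun hc => glue_apply_slice0 μ 1 U A A' hc hx0
  rcases hT with ha | hb
  · subst ha
    have hba : b ≠ a := (ne_of_lt hab').symm
    have hsd : spatialDir a (x, ⟨(a, b), hab⟩) = b := by simp [spatialDir]
    simp only [plaqCost, plaqEdge, hsd, gaugeAct, hba, hx0, ne_eq, not_false_eq_true, and_self, if_true, plaquetteHolonomy,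
      hv1, hv2 hba, hv4 hba]
  · subst hb
    have hab'' : a ≠ b := ne_of_lt hab'
    have hsd : spatialDir b (x, ⟨(a, b), hab⟩) = a := by simp [spatialDir, hab'']
    simp only [plaqCost, plaqEdge, hsd, gaugeAct, hab'', hx0, ne_eq, not_false_eq_true, and_self, if_true, plaquetteHolonomy,
      hv1, hv2 hab'', hv4 hab'']
    rw [← Literature.Barriers.QuantumFields.FiniteTemperature.trace_re_rep_inv ρ hU]
    congr 3
    group

/-- The slice-`0` spatial plaquettes of a glued configuration are those of `A`. -/
theorem plaqCost_glue_spatial_zero (j : ℕ) (U A A' : GaugeConfig 4 (n + 1) G) {p : Plaquette 4 (n + 1)}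
    (hp : isTemporal μ p = false ∧ (p.1 μ).val = 0) : plaqCost ρ (glue μ j U A A') p = plaqCost ρ A p := by
  obtain ⟨x, ⟨⟨a, b⟩, hab⟩⟩ := p
  have hx0 : x μ = 0 := (ZMod.val_eq_zero _).mp hp.2
  have hT : ¬ (a = μ ∨ b = μ) := fun h => by
    have := (isTemporal_iff μ (x, ⟨(a, b), hab⟩)).mpr h; rw [hp.1] at this; exact Bool.false_ne_true this
  push Not at hT
  simp only [plaqCost]
  refine congrArg (fun g : G => (N : ℝ) - (ρ g).trace.re) (plaquetteHolonomy_congr ?_ ?_ ?_ ?_)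
  · exact glue_apply_slice0 μ j U A A' hT.1 hx0
  · exact glue_apply_slice0 μ j U A A' hT.2 (by show (x.shift a) μ = 0; rw [shift_apply_of_ne' x (Ne.symm hT.1)]; exact hx0)
  · exact glue_apply_slice0 μ j U A A' hT.1 (by show (x.shift b) μ = 0; rw [shift_apply_of_ne' x (Ne.symm hT.2)]; exact hx0)
  · exact glue_apply_slice0 μ j U A A' hT.2 hx0

/-- The slice-`1` spatial plaquettes of the one-layer glued configuration are those of the translated `A'`. -/
theorem plaqCost_glue_spatial_one (hn : 1 ≤ n) (U A A' : GaugeConfig 4 (n + 1) G) {p : Plaquette 4 (n + 1)}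
    (hp : isTemporal μ p = false ∧ (p.1 μ).val = 1) :
    plaqCost ρ (glue μ 1 U A A') p = plaqCost ρ (translate μ (-(1 : ZMod (n + 1))) A') p := by
  have h10 : ((1 : ℕ) : ZMod (n + 1)) ≠ 0 := natCast_ne_zero_of_le (n := n) 1 le_rfl hn
  obtain ⟨x, ⟨⟨a, b⟩, hab⟩⟩ := p
  have hx1 : x μ = ((1 : ℕ) : ZMod (n + 1)) := by
    rw [Nat.cast_one]; rw [← ZMod.natCast_zmod_val (x μ), hp.2, Nat.cast_one]
  have hT : ¬ (a = μ ∨ b = μ) := fun h => by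
    have := (isTemporal_iff μ (x, ⟨(a, b), hab⟩)).mpr h; rw [hp.1] at this; exact Bool.false_ne_true this
  push Not at hT
  simp only [plaqCost]
  have key : ∀ (y : Site 4 (n + 1)) (c : Fin 4), c ≠ μ → y μ = ((1 : ℕ) : ZMod (n + 1)) →
      glue μ 1 U A A' (y, c) = translate μ (-(1 : ZMod (n + 1))) A' (y, c) := by
    intro y c hc hy
    rw [glue_apply_sliceJ μ 1 U A A' hc h10 hy, translate_apply, Pi.single_neg, ← sub_eq_add_neg, Nat.cast_one]
  refine congrArg (fun g : G => (N : ℝ) - (ρ g).trace.re) (plaquetteHolonomy_congr ?_ ?_ ?_ ?_)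
  · exact key _ _ hT.1 hx1
  · exact key _ _ hT.2 (by rw [shift_apply_of_ne' x (Ne.symm hT.1)]; exact hx1)
  · exact key _ _ hT.1 (by rw [shift_apply_of_ne' x (Ne.symm hT.2)]; exact hx1)
  · exact key _ _ hT.2 hx1

/-- **The one-layer slab action of a glued configuration**: two half spatial actions and the temporal Gram coupling. -/
theorem slabAction_one_glue (hn : 1 ≤ n) (hU : ∀ g, ρ g ∈ Matrix.unitaryGroup (Fin N) ℂ) (U A A' : GaugeConfig 4 (n + 1) G) :
    slabAction ρ μ 1 (glue μ 1 U A A') = spatialHalf ρ μ A + spatialHalf ρ μ A' +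
      ∑ p : Plaquette 4 (n + 1), (if isTemporal μ p = true ∧ (p.1 μ).val = 0 then
        ((N : ℝ) - (ρ (gaugeAct μ U A' (plaqEdge μ p) * (A (plaqEdge μ p))⁻¹)).trace.re) else 0) := by
  unfold slabAction spatialHalf
  -- the weight of `[0,1]` as a sum of three indicators
  have hw : ∀ p : Plaquette 4 (n + 1), slabWeight μ 1 p * plaqCost ρ (glue μ 1 U A A') p =
      (if isTemporal μ p = false ∧ (p.1 μ).val = 0 then (1 / 2 : ℝ) else 0) * plaqCost ρ A p +
      (if isTemporal μ p = false ∧ (p.1 μ).val = 1 then (1 / 2 : ℝ) else 0) * plaqCost ρ (translate μ (-(1 : ZMod (n + 1))) A') p +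
      (if isTemporal μ p = true ∧ (p.1 μ).val = 0 then
        ((N : ℝ) - (ρ (gaugeAct μ U A' (plaqEdge μ p) * (A (plaqEdge μ p))⁻¹)).trace.re) else 0) := by
    intro p
    unfold slabWeight
    by_cases hT : isTemporal μ p = true
    · simp only [hT, if_true, true_and, Bool.true_eq_false, false_and, if_false, zero_mul, zero_add]
      by_cases h0 : (p.1 μ).val = 0
      · rw [if_pos (by omega), if_pos h0, one_mul, plaqCost_glue_one_temporal ρ μ hn hU U A A' ⟨hT, h0⟩]
      · rw [if_neg (by omega), if_neg h0, zero_mul]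
    · have hT' : isTemporal μ p = false := by simpa using hT
      simp only [hT', Bool.false_eq_true, if_false, true_and, false_and, add_zero]
      by_cases h0 : (p.1 μ).val = 0
      · rw [if_neg (by omega), if_pos (Or.inl h0), if_pos h0, if_neg (by omega), zero_mul, add_zero,
          plaqCost_glue_spatial_zero ρ μ 1 U A A' ⟨hT', h0⟩]
      · by_cases h1 : (p.1 μ).val = 1
        · rw [if_neg (by omega), if_pos (Or.inr h1), if_neg h0, if_pos h1, zero_mul, zero_add,
            plaqCost_glue_spatial_one ρ μ hn U A A' ⟨hT', h1⟩]
        · rw [if_neg (by omega), if_neg (by omega), if_neg h0, if_neg h1, zero_mul, zero_mul, zero_mul, add_zero]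
  simp_rw [hw]
  rw [Finset.sum_add_distrib, Finset.sum_add_distrib]
  congr 2
  -- reindex the slice-1 spatial plaquettes
  rw [← Equiv.sum_comp (plaqShift μ (1 : ZMod (n + 1)))]
  refine Finset.sum_congr rfl fun p _ => ?_
  have hfst : ((plaqShift μ (1 : ZMod (n + 1))) p).1 = p.1 + Pi.single μ 1 := rfl
  have hsnd : ((plaqShift μ (1 : ZMod (n + 1))) p).2 = p.2 := rfl
  have hT : isTemporal μ ((plaqShift μ (1 : ZMod (n + 1))) p) = isTemporal μ p := rfl
  have hlev : (((plaqShift μ (1 : ZMod (n + 1))) p).1 μ).val = 1 ↔ (p.1 μ).val = 0 := by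
    rw [hfst, Pi.add_apply, Pi.single_eq_same, val_add_one]
    split_ifs with h
    · omega
    · simp only [false_iff]; omega
  simp only [hT, hlev]
  congr 1
  simp only [plaqCost, plaquetteHolonomy_translate, hfst, hsnd, Pi.single_neg, add_neg_cancel_right]

end PSDKernel

end Summit.QuantumFields.YangMills.Theorems.CentreWallReflection.Slab

end
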